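import Literature.NumberTheory.Sieve.PrimePairsSieveBound
import HarnessLib

/-!
# The crude upper bound `∑_{n ≤ N} Λ(n) Λ(n + h) ≪ (h/φ(h)) N`, uniformly in the shift

Topic `Literature/NumberTheory/Sieve`.  Companion of `PrimePairsSieveBound.lean` (the dimension-2 sieve
bound `#{p ≤ N : p + h prime} ≤ C (h/φ(h)) N/(log N)²` for `1 ≤ h ≤ N`, from the proved
`Lichtman2020_shiftedPrimeSieveBound_holds`).  Everything in this file is PROVED; no definition and no
named fact is introduced.

* `card_primePairs_le_uniform` — the same sieve bound WITHOUT the restriction `h ≤ N`: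
  there is an absolute `C` with `#{p ≤ N : p + h prime} ≤ C (h/φ(h)) N/(log N)²` for all `N ≥ 2`, `h ≥ 1`
  (sift `p + h` by the primes `≤ √N` instead of `≤ √(N + h)`; Montgomery–Vaughan, *Multiplicative Number
  Theory I*, Cor. 3.14 and p. 82: "uniformly in `r`").
* `sum_vonMangoldt_mul_shift_le` — **the weighted form**: there is an absolute `C` such that for all
  `N ≥ 2` and `1 ≤ h ≤ N²`,
  `∑_{n ≤ N} Λ(n) Λ(n + h) ≤ C (h/φ(h)) N`.
  This is the "trivial bound" for the prime-pair correlation used, e.g., by Matomäki–Merikoski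
  (IMRN 2023, arXiv:2112.11412, §7, first paragraph: "[Theorems 1.2 and 1.3] follow from Lemma 3.1(i) with
  `w₁ = w₂ = X^{1/4}` and `m₁ = m₂ = 0` unless `η` is large") to dispose of the degenerate ranges of their
  Theorem 1.3; here it is derived from the sieve count of prime pairs plus an elementary count of the
  higher prime powers `p^k`, `k ≥ 2`, among `n ≤ N` (at most `√N log₂ N`) and among `n + h`, `n ≤ N`
  (squares: at most `√N + 1` since `√(N+h) − √h ≤ √N`; cubes and higher: at most `(N+h)^{1/3} log₂(N+h)`).
* `sum_vonMangoldt_mul_shift_le_of_odd` — for ODD `h` only powers of `2` can pair up: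
  `∑_{n ≤ N} Λ(n) Λ(n + h) ≤ 2 (log₂(N+h) + 1) · log N · log(N + h)`.

## References

* H. L. Montgomery, R. C. Vaughan, *Multiplicative Number Theory I*, CUP 2007, Corollary 3.14 and the
  remark following it (p. 82). [MontgomeryVaughan2007]
* K. Matomäki, J. Merikoski, *Siegel zeros, twin primes, Goldbach's conjecture, and primes in short
  intervals*, IMRN 2023 (arXiv:2112.11412), §7 first paragraph. [MatomakiMerikoski2023]
-/

noncomputable section

open Finset Real
open scoped ArithmeticFunction.vonMangoldt

namespace Literature.NumberTheory.Sieve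

namespace PrimePairsVonMangoldt

open Lichtman2020 (not_hasPrimeFactorIn_of_prime primeCounting_le_six_mul_div_log card_primesLE_le_self
  log_sq_le_sqrt)

/-! ### Prime pairs, uniformly in the shift -/

/-- **The sieve bound for prime pairs, uniformly in the shift**: there is an absolute `C > 0` such that
`#{p ≤ N : p + h prime} ≤ C (h/φ(h)) N/(log N)²` for all `N ≥ 2` and ALL `h ≥ 1` (no upper bound on `h`):
a prime `p + h > √N` has no prime factor in `[2, √N]`, so `Lichtman2020_shiftedPrimeSieveBound_holds`
with `Q = √N` counts these `p`, and the `p` with `p + h ≤ √N` number at most `√N`.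
[cite: MontgomeryVaughan2007, Corollary 3.14] -/
theorem card_primePairs_le_uniform : ∃ C : ℝ, 0 < C ∧ ∀ N h : ℕ, 2 ≤ N → 1 ≤ h →
    (#{p ∈ Nat.primesLE N | (p + h).Prime} : ℝ) ≤
      C * (((h : ℝ) / Nat.totient h) * ((N : ℝ) / Real.log N ^ 2)) := by
  obtain ⟨C₀, hC₀⟩ := Lichtman2020_shiftedPrimeSieveBound_holds
  refine ⟨12 * Real.log 2 * max C₀ 0 + 32, by positivity, fun N h hN hh => ?_⟩
  have hl2 : (0.6931471803 : ℝ) < Real.log 2 := Real.log_two_gt_d9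
  have hC₀0 : 0 ≤ max C₀ 0 := le_max_right _ _
  have hN2 : (2 : ℝ) ≤ N := by exact_mod_cast hN
  have hN0 : (0 : ℝ) < N := by linarith
  have hlogN : 0 < Real.log N := Real.log_pos (by linarith)
  have hφ0 : (0 : ℝ) < Nat.totient h := by exact_mod_cast Nat.totient_pos.mpr (by omega)
  have hw1 : 1 ≤ (h : ℝ) / Nat.totient h := by
    rw [le_div_iff₀ hφ0, one_mul]; exact_mod_cast Nat.totient_le h
  have hT0 : 0 < (N : ℝ) / Real.log N ^ 2 := by positivity
  set T : ℝ := ((h : ℝ) / Nat.totient h) * ((N : ℝ) / Real.log N ^ 2) with hT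
  have hTge : (N : ℝ) / Real.log N ^ 2 ≤ T := by
    rw [hT]; exact le_mul_of_one_le_left hT0.le hw1
  have hTpos : 0 < T := lt_of_lt_of_le hT0 hTge
  have hSπ : (#{p ∈ Nat.primesLE N | (p + h).Prime} : ℝ) ≤ N := by
    have := (Finset.card_filter_le (Nat.primesLE N) (fun p => (p + h).Prime)).trans
      (card_primesLE_le_self N)
    exact_mod_cast this
  -- small `N`
  by_cases hN16 : N < 16
  · have hN16' : (N : ℝ) < 16 := by exact_mod_cast hN16
    have hlog16 : Real.log N ≤ 2.78 := by
      have h1 : Real.log N ≤ Real.log 16 := Real.log_le_log hN0 hN16'.le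
      have h2 : Real.log 16 = 4 * Real.log 2 := by
        rw [show (16 : ℝ) = 2 ^ 4 by norm_num, Real.log_pow]; push_cast; ring
      have hl2' : Real.log 2 < 0.6931471808 := Real.log_two_lt_d9
      linarith
    have hkey : (N : ℝ) ≤ 32 * ((N : ℝ) / Real.log N ^ 2) := by
      rw [mul_div_assoc', le_div_iff₀ (by positivity)]
      have : Real.log N ^ 2 ≤ 8 := by nlinarith
      nlinarith
    calc (#{p ∈ Nat.primesLE N | (p + h).Prime} : ℝ) ≤ N := hSπ
      _ ≤ 32 * ((N : ℝ) / Real.log N ^ 2) := hkey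
      _ ≤ 32 * T := mul_le_mul_of_nonneg_left hTge (by norm_num)
      _ ≤ (12 * Real.log 2 * max C₀ 0 + 32) * T := by
          apply mul_le_mul_of_nonneg_right _ hTpos.le
          have : 0 ≤ 12 * Real.log 2 * max C₀ 0 := by positivity
          linarith
  push Not at hN16
  have hN16' : (16 : ℝ) ≤ N := by exact_mod_cast hN16
  -- `Q = √N`
  set Q : ℝ := Real.sqrt N with hQ
  have hQ2 : 2 ≤ Q := by
    rw [hQ, show (2 : ℝ) = Real.sqrt 4 by
      rw [show (4 : ℝ) = 2 ^ 2 by norm_num, Real.sqrt_sq (by norm_num : (0 : ℝ) ≤ 2)]]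
    exact Real.sqrt_le_sqrt (by linarith)
  have hQN : Q ≤ N := by
    rw [hQ, Real.sqrt_le_left (by linarith)]
    nlinarith only [hN16']
  have hQ0 : 0 < Q := by linarith
  have hlogQ : Real.log Q = Real.log N / 2 := by
    rw [hQ, Real.log_sqrt hN0.le]
  have hlogQ0 : 0 < Real.log Q := by rw [hlogQ]; linarith
  -- split at `p + h ≤ Q`
  have hsplit : (#{p ∈ Nat.primesLE N | (p + h).Prime} : ℝ) ≤
      #{p ∈ Nat.primesLE N | ¬ HasPrimeFactorIn 2 Q (p + h)} + #(Nat.primesLE ⌊Q⌋₊) := by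
    have hsub : {p ∈ Nat.primesLE N | (p + h).Prime} ⊆
        {p ∈ Nat.primesLE N | ¬ HasPrimeFactorIn 2 Q (p + h)} ∪ Nat.primesLE ⌊Q⌋₊ := by
      intro p hp
      rw [Finset.mem_filter] at hp
      rw [Finset.mem_union, Finset.mem_filter]
      by_cases hpQ : Q < ((p + h : ℕ) : ℝ)
      · exact Or.inl ⟨hp.1, not_hasPrimeFactorIn_of_prime hp.2 hpQ⟩
      · right
        push Not at hpQ
        rw [Nat.mem_primesLE]
        refine ⟨Nat.le_floor ?_, (Nat.mem_primesLE.mp hp.1).2⟩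
        push_cast at hpQ
        have : (0 : ℝ) ≤ h := Nat.cast_nonneg _
        linarith
    calc (#{p ∈ Nat.primesLE N | (p + h).Prime} : ℝ)
        ≤ #({p ∈ Nat.primesLE N | ¬ HasPrimeFactorIn 2 Q (p + h)} ∪ Nat.primesLE ⌊Q⌋₊) := by
          exact_mod_cast Finset.card_le_card hsub
      _ ≤ _ := by exact_mod_cast Finset.card_union_le _ _
  -- the sifted part
  have hsift : (#{p ∈ Nat.primesLE N | ¬ HasPrimeFactorIn 2 Q (p + h)} : ℝ) ≤
      12 * Real.log 2 * max C₀ 0 * T := by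
    have hb := hC₀ N h hh 2 Q le_rfl hQ2 hQN
    have hπ := primeCounting_le_six_mul_div_log hN
    have hr : Real.log 2 / Real.log Q = 2 * Real.log 2 / Real.log N := by
      rw [hlogQ]; field_simp
    have hw0 : 0 ≤ (h : ℝ) / Nat.totient h := by positivity
    calc (#{p ∈ Nat.primesLE N | ¬ HasPrimeFactorIn 2 Q (p + h)} : ℝ)
        ≤ C₀ * Nat.primeCounting N * (Real.log 2 / Real.log Q) * ((h : ℝ) / Nat.totient h) := hb
      _ ≤ max C₀ 0 * Nat.primeCounting N * (Real.log 2 / Real.log Q) * ((h : ℝ) / Nat.totient h) := by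
          gcongr
          exact le_max_left _ _
      _ ≤ max C₀ 0 * (6 * ((N : ℝ) / Real.log N)) * (Real.log 2 / Real.log Q) *
            ((h : ℝ) / Nat.totient h) := by
          gcongr
      _ = 12 * Real.log 2 * max C₀ 0 * T := by
          rw [hT, hr]; field_simp; ring
  -- the small primes
  have hsmall : (#(Nat.primesLE ⌊Q⌋₊) : ℝ) ≤ 32 * T := by
    have h1 : (#(Nat.primesLE ⌊Q⌋₊) : ℝ) ≤ Q := by
      calc (#(Nat.primesLE ⌊Q⌋₊) : ℝ) ≤ ⌊Q⌋₊ := by exact_mod_cast card_primesLE_le_self _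
        _ ≤ Q := Nat.floor_le hQ0.le
    have h3 : Q ≤ 16 * ((N : ℝ) / Real.log N ^ 2) := by
      have hls := log_sq_le_sqrt (show (1 : ℝ) ≤ N by linarith)
      rw [mul_div_assoc', le_div_iff₀ (by positivity), hQ]
      calc Real.sqrt N * Real.log N ^ 2 ≤ Real.sqrt N * (16 * Real.sqrt N) :=
            mul_le_mul_of_nonneg_left hls (Real.sqrt_nonneg _)
        _ = 16 * N := by rw [mul_left_comm, Real.mul_self_sqrt hN0.le]
    calc (#(Nat.primesLE ⌊Q⌋₊) : ℝ) ≤ 16 * ((N : ℝ) / Real.log N ^ 2) := h1.trans h3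
      _ ≤ 32 * ((N : ℝ) / Real.log N ^ 2) := by linarith
      _ ≤ 32 * T := mul_le_mul_of_nonneg_left hTge (by norm_num)
  calc (#{p ∈ Nat.primesLE N | (p + h).Prime} : ℝ)
      ≤ 12 * Real.log 2 * max C₀ 0 * T + 32 * T := hsplit.trans (add_le_add hsift hsmall)
    _ = (12 * Real.log 2 * max C₀ 0 + 32) * T := by ring

/-! ### Counting higher prime powers -/

open scoped Classical in
/-- The `n` in a finite set `S` such that `n + h = p^k` with `p ≥ 1`, `k ≥ k₀ ≥ 1` and `p^k ≤ M` number
at most `M^{1/k₀} · log₂ M`: such a pair has `p ≤ M^{1/k₀}` and `k ≤ log₂ M`. [folklore] -/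
theorem card_filter_shift_eq_pow_le (S : Finset ℕ) (h M k₀ : ℕ) (hk₀ : 1 ≤ k₀) :
    (#{n ∈ S | ∃ p k : ℕ, 2 ≤ p ∧ k₀ ≤ k ∧ p ^ k ≤ M ∧ n + h = p ^ k} : ℝ) ≤
      (M : ℝ) ^ ((1 : ℝ) / k₀) * Nat.log 2 M := by
  classical
  set T := (Icc 1 ⌊(M : ℝ) ^ ((1 : ℝ) / k₀)⌋₊) ×ˢ (Icc k₀ (Nat.log 2 M)) with hT
  have hsub : {n ∈ S | ∃ p k : ℕ, 2 ≤ p ∧ k₀ ≤ k ∧ p ^ k ≤ M ∧ n + h = p ^ k} ⊆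
      T.image (fun pk : ℕ × ℕ => pk.1 ^ pk.2 - h) := by
    intro n hn
    rw [Finset.mem_filter] at hn
    obtain ⟨-, p, k, hp, hk, hpkM, hnh⟩ := hn
    rw [Finset.mem_image]
    refine ⟨(p, k), ?_, by simp [← hnh]⟩
    rw [hT, Finset.mem_product, Finset.mem_Icc, Finset.mem_Icc]
    refine ⟨⟨by omega, ?_⟩, hk, ?_⟩
    · -- `p ≤ M^{1/k₀}` since `p^{k₀} ≤ p^k ≤ M`
      refine Nat.le_floor ?_
      have hpk₀ : p ^ k₀ ≤ M := (Nat.pow_le_pow_right (by omega) hk).trans hpkM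
      have hk₀0 : (0 : ℝ) < k₀ := by exact_mod_cast hk₀
      have h1 : ((p : ℝ) ^ (k₀ : ℝ)) ^ ((1 : ℝ) / k₀) = p := by
        rw [← Real.rpow_mul (by positivity), mul_one_div_cancel hk₀0.ne', Real.rpow_one]
      rw [← h1, Real.rpow_natCast]
      exact Real.rpow_le_rpow (by positivity) (by exact_mod_cast hpk₀) (by positivity)
    · -- `k ≤ log₂ M` since `2^k ≤ p^k ≤ M`
      exact Nat.le_log_of_pow_le one_lt_two ((Nat.pow_le_pow_left hp k).trans hpkM)
  calc (#{n ∈ S | ∃ p k : ℕ, 2 ≤ p ∧ k₀ ≤ k ∧ p ^ k ≤ M ∧ n + h = p ^ k} : ℝ)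
      ≤ #(T.image (fun pk : ℕ × ℕ => pk.1 ^ pk.2 - h)) := by exact_mod_cast Finset.card_le_card hsub
    _ ≤ #T := by exact_mod_cast Finset.card_image_le
    _ = (⌊(M : ℝ) ^ ((1 : ℝ) / k₀)⌋₊ : ℝ) * ((Nat.log 2 M + 1 - k₀ : ℕ) : ℝ) := by
        rw [hT, Finset.card_product, Nat.card_Icc, Nat.card_Icc, Nat.add_sub_cancel, Nat.cast_mul]
    _ ≤ (M : ℝ) ^ ((1 : ℝ) / k₀) * Nat.log 2 M := by
        gcongr
        · exact Nat.floor_le (by positivity)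
        · exact_mod_cast (show Nat.log 2 M + 1 - k₀ ≤ Nat.log 2 M by omega)

open scoped Classical in
/-- The `n ≤ N` with `n + h` a perfect square number at most `√N + 1`
(`Nat.sqrt (N + h) − Nat.sqrt h ≤ Nat.sqrt N + 1`). [folklore] -/
theorem card_filter_shift_eq_sq_le (N h : ℕ) :
    (#{n ∈ Icc 1 N | ∃ p : ℕ, n + h = p ^ 2} : ℝ) ≤ Real.sqrt N + 1 := by
  classical
  have hsub : {n ∈ Icc 1 N | ∃ p : ℕ, n + h = p ^ 2} ⊆
      (Ioc (Nat.sqrt h) (Nat.sqrt (N + h))).image (fun p => p ^ 2 - h) := by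
    intro n hn
    rw [Finset.mem_filter, Finset.mem_Icc] at hn
    obtain ⟨⟨hn1, hnN⟩, p, hp⟩ := hn
    rw [Finset.mem_image]
    refine ⟨p, ?_, by rw [← hp, Nat.add_sub_cancel]⟩
    rw [Finset.mem_Ioc, Nat.sqrt_lt', Nat.le_sqrt', ← hp]
    omega
  have hcard : #{n ∈ Icc 1 N | ∃ p : ℕ, n + h = p ^ 2} ≤ Nat.sqrt N + 1 := by
    calc #{n ∈ Icc 1 N | ∃ p : ℕ, n + h = p ^ 2}
        ≤ #((Ioc (Nat.sqrt h) (Nat.sqrt (N + h))).image (fun p => p ^ 2 - h)) := Finset.card_le_card hsub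
      _ ≤ #(Ioc (Nat.sqrt h) (Nat.sqrt (N + h))) := Finset.card_image_le
      _ = Nat.sqrt (N + h) - Nat.sqrt h := Nat.card_Ioc _ _
      _ ≤ Nat.sqrt N + 1 := by
          -- `N + h < (√N + √h + 2)²`, so `√(N+h) ≤ √N + √h + 1`
          have h1 := Nat.lt_succ_sqrt' N
          have h2 := Nat.lt_succ_sqrt' h
          simp only [Nat.succ_eq_add_one] at h1 h2
          have h3 : Nat.sqrt (N + h) < Nat.sqrt N + Nat.sqrt h + 2 := by
            rw [Nat.sqrt_lt']
            nlinarith only [h1, h2, Nat.zero_le (Nat.sqrt N * Nat.sqrt h), Nat.zero_le (Nat.sqrt N),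
              Nat.zero_le (Nat.sqrt h)]
          omega
  have hsq : (Nat.sqrt N : ℝ) ≤ Real.sqrt N := by
    rw [Real.le_sqrt (Nat.cast_nonneg _) (Nat.cast_nonneg _)]
    exact_mod_cast Nat.sqrt_le' N
  calc (#{n ∈ Icc 1 N | ∃ p : ℕ, n + h = p ^ 2} : ℝ) ≤ ((Nat.sqrt N + 1 : ℕ) : ℝ) := by
        exact_mod_cast hcard
    _ ≤ Real.sqrt N + 1 := by push_cast; linarith

/-- A prime power that is not a prime is `p^k` with `p` prime and `k ≥ 2`. [folklore] -/
theorem exists_eq_prime_pow_two_le {m : ℕ} (hm : IsPrimePow m) (hm' : ¬ m.Prime) :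
    ∃ p k : ℕ, p.Prime ∧ 2 ≤ k ∧ m = p ^ k := by
  obtain ⟨p, k, hp, hk, rfl⟩ := (isPrimePow_nat_iff m).mp hm
  refine ⟨p, k, hp, ?_, rfl⟩
  by_contra hk2
  have : k = 1 := by omega
  subst this
  exact hm' (by simpa using hp)

/-! ### The weighted bound -/

/-- Pointwise: `Λ(n)Λ(n+h) ≤ log N · log(N+h) · (1_A + 1_B + 1_C)(n)` for `1 ≤ n ≤ N`, where
`A = {n prime, n + h prime}`, `B = {n a higher prime power}`, `C = {n + h a higher prime power}`. [folklore] -/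
theorem vonMangoldt_mul_shift_le_indicator {N h n : ℕ} (hn1 : 1 ≤ n) (hnN : n ≤ N) :
    Λ n * Λ (n + h) ≤ Real.log N * Real.log ((N : ℝ) + h) *
      ((if n.Prime ∧ (n + h).Prime then 1 else 0) +
        (if IsPrimePow n ∧ ¬ n.Prime then 1 else 0) +
        (if IsPrimePow (n + h) ∧ ¬ (n + h).Prime then 1 else 0)) := by
  have hΛn : Λ n ≤ Real.log N :=
    ArithmeticFunction.vonMangoldt_le_log.trans (Real.log_le_log (by exact_mod_cast hn1) (by exact_mod_cast hnN))
  have hΛnh : Λ (n + h) ≤ Real.log ((N : ℝ) + h) := by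
    refine ArithmeticFunction.vonMangoldt_le_log.trans
      (Real.log_le_log (by exact_mod_cast (show 0 < n + h by omega)) ?_)
    push_cast; exact_mod_cast (show n + h ≤ N + h by omega)
  have h0n : 0 ≤ Λ n := ArithmeticFunction.vonMangoldt_nonneg
  have h0nh : 0 ≤ Λ (n + h) := ArithmeticFunction.vonMangoldt_nonneg
  have hlogN : 0 ≤ Real.log N := Real.log_natCast_nonneg N
  have hlogNh : 0 ≤ Real.log ((N : ℝ) + h) := by
    have : Real.log ((N : ℝ) + h) = Real.log ((N + h : ℕ) : ℝ) := by push_cast; ring_nf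
    rw [this]; exact Real.log_natCast_nonneg _
  have hprod : Λ n * Λ (n + h) ≤ Real.log N * Real.log ((N : ℝ) + h) :=
    mul_le_mul hΛn hΛnh h0nh hlogN
  by_cases hΛ : Λ n * Λ (n + h) = 0
  · rw [hΛ]
    refine mul_nonneg (mul_nonneg hlogN hlogNh) ?_
    refine add_nonneg (add_nonneg ?_ ?_) ?_ <;> split_ifs <;> norm_num
  · have hn' : IsPrimePow n := ArithmeticFunction.vonMangoldt_ne_zero_iff.mp (left_ne_zero_of_mul hΛ)
    have hnh' : IsPrimePow (n + h) :=
      ArithmeticFunction.vonMangoldt_ne_zero_iff.mp (right_ne_zero_of_mul hΛ)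
    have hind : (1 : ℝ) ≤ (if n.Prime ∧ (n + h).Prime then 1 else 0) +
        (if IsPrimePow n ∧ ¬ n.Prime then 1 else 0) +
        (if IsPrimePow (n + h) ∧ ¬ (n + h).Prime then 1 else 0) := by
      by_cases hp : n.Prime
      · by_cases hq : (n + h).Prime
        · rw [if_pos ⟨hp, hq⟩]
          have h2 : (0 : ℝ) ≤ (if IsPrimePow n ∧ ¬ n.Prime then 1 else 0) := by split_ifs <;> norm_num
          have h3 : (0 : ℝ) ≤ (if IsPrimePow (n + h) ∧ ¬ (n + h).Prime then 1 else 0) := by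
            split_ifs <;> norm_num
          linarith
        · rw [if_pos (show IsPrimePow (n + h) ∧ ¬ (n + h).Prime from ⟨hnh', hq⟩)]
          have h1 : (0 : ℝ) ≤ (if n.Prime ∧ (n + h).Prime then 1 else 0) := by split_ifs <;> norm_num
          have h2 : (0 : ℝ) ≤ (if IsPrimePow n ∧ ¬ n.Prime then 1 else 0) := by split_ifs <;> norm_num
          linarith
      · rw [if_pos (show IsPrimePow n ∧ ¬ n.Prime from ⟨hn', hp⟩)]
        have h1 : (0 : ℝ) ≤ (if n.Prime ∧ (n + h).Prime then 1 else 0) := by split_ifs <;> norm_num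
        have h3 : (0 : ℝ) ≤ (if IsPrimePow (n + h) ∧ ¬ (n + h).Prime then 1 else 0) := by
          split_ifs <;> norm_num
        linarith
    calc Λ n * Λ (n + h) ≤ Real.log N * Real.log ((N : ℝ) + h) * 1 := by rw [mul_one]; exact hprod
      _ ≤ _ := mul_le_mul_of_nonneg_left hind (mul_nonneg hlogN hlogNh)

/-- `log x ≤ 9 x^{1/9}` for `x ≥ 0` (Mathlib's `log x ≤ x^ε/ε`). [folklore] -/
theorem log_le_nine_mul_rpow {x : ℝ} (hx : 0 ≤ x) : Real.log x ≤ 9 * x ^ ((1 : ℝ) / 9) := by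
  have := Real.log_le_rpow_div hx (show (0 : ℝ) < 1 / 9 by norm_num)
  linarith [show x ^ ((1 : ℝ) / 9) / (1 / 9) = 9 * x ^ ((1 : ℝ) / 9) by ring]

/-- **The crude bound for the prime-pair correlation, uniformly in the shift**: there is an absolute
`C > 0` such that for all `N ≥ 2` and `1 ≤ h ≤ N²`,
`∑_{n ≤ N} Λ(n) Λ(n + h) ≤ C (h/φ(h)) N`.
(Prime pairs by `card_primePairs_le_uniform` with the weight `log N log(N+h) ≤ 3 log² N`; the higher
prime powers among the `n` and the `n + h` are `O(N^{2/3} log N)` in number.)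
[cite: MontgomeryVaughan2007, Corollary 3.14] -/
theorem sum_vonMangoldt_mul_shift_le : ∃ C : ℝ, 0 < C ∧ ∀ N h : ℕ, 2 ≤ N → 1 ≤ h → h ≤ N ^ 2 →
    ∑ n ∈ Icc 1 N, Λ n * Λ (n + h) ≤ C * ((h : ℝ) / Nat.totient h) * N := by
  obtain ⟨C₀, hC₀, H⟩ := card_primePairs_le_uniform
  refine ⟨3 * C₀ + 200000, by positivity, fun N h hN hh hhN => ?_⟩
  classical
  have hN2 : (2 : ℝ) ≤ N := by exact_mod_cast hN
  have hN0 : (0 : ℝ) < N := by linarith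
  have hN1 : (1 : ℝ) ≤ N := by linarith
  have hlogN : 0 < Real.log N := Real.log_pos (by linarith)
  have hl2 : (0.6931471803 : ℝ) < Real.log 2 := Real.log_two_gt_d9
  have hlog2N : Real.log 2 ≤ Real.log N := Real.log_le_log two_pos hN2
  have hφ0 : (0 : ℝ) < Nat.totient h := by exact_mod_cast Nat.totient_pos.mpr (by omega)
  have hw1 : 1 ≤ (h : ℝ) / Nat.totient h := by
    rw [le_div_iff₀ hφ0, one_mul]; exact_mod_cast Nat.totient_le h
  set w : ℝ := (h : ℝ) / Nat.totient h with hw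
  -- `N + h ≤ 2 N²`, `log (N + h) ≤ 3 log N`
  have hhN' : (h : ℝ) ≤ (N : ℝ) ^ 2 := by exact_mod_cast hhN
  have hNN2 : (N : ℝ) ≤ (N : ℝ) ^ 2 := by nlinarith only [hN1]
  have hNh : (N : ℝ) + h ≤ 2 * (N : ℝ) ^ 2 := by linarith only [hhN', hNN2]
  have hNh3 : (N : ℝ) + h ≤ (N : ℝ) ^ 3 := by
    have h3 : (N : ℝ) ^ 3 = (N : ℝ) ^ 2 * (N - 2) + 2 * (N : ℝ) ^ 2 := by ring
    have h4 : 0 ≤ (N : ℝ) ^ 2 * (N - 2) := mul_nonneg (sq_nonneg _) (by linarith only [hN2])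
    linarith only [h3, h4, hNh]
  have hNh0 : (0 : ℝ) < (N : ℝ) + h := by positivity
  have hlogNh : Real.log ((N : ℝ) + h) ≤ 3 * Real.log N := by
    calc Real.log ((N : ℝ) + h) ≤ Real.log ((N : ℝ) ^ 3) := Real.log_le_log hNh0 hNh3
      _ = 3 * Real.log N := by rw [Real.log_pow]; push_cast; ring
  have hlogNh0 : 0 ≤ Real.log ((N : ℝ) + h) := Real.log_nonneg (by linarith)
  set L : ℝ := Real.log N with hL
  -- the three indicator sets
  set A := {n ∈ Icc 1 N | n.Prime ∧ (n + h).Prime} with hA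
  set B := {n ∈ Icc 1 N | IsPrimePow n ∧ ¬ n.Prime} with hB
  set Cs := {n ∈ Icc 1 N | IsPrimePow (n + h) ∧ ¬ (n + h).Prime} with hCs
  -- pointwise bound summed
  have hsum : ∑ n ∈ Icc 1 N, Λ n * Λ (n + h) ≤ L * Real.log ((N : ℝ) + h) * (#A + #B + #Cs) := by
    calc ∑ n ∈ Icc 1 N, Λ n * Λ (n + h)
        ≤ ∑ n ∈ Icc 1 N, L * Real.log ((N : ℝ) + h) *
            ((if n.Prime ∧ (n + h).Prime then 1 else 0) +
              (if IsPrimePow n ∧ ¬ n.Prime then 1 else 0) +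
              (if IsPrimePow (n + h) ∧ ¬ (n + h).Prime then 1 else 0)) := by
          refine Finset.sum_le_sum fun n hn => ?_
          rw [Finset.mem_Icc] at hn
          exact vonMangoldt_mul_shift_le_indicator hn.1 hn.2
      _ = L * Real.log ((N : ℝ) + h) * (#A + #B + #Cs) := by
          rw [← Finset.mul_sum, Finset.sum_add_distrib, Finset.sum_add_distrib, Finset.sum_boole,
            Finset.sum_boole, Finset.sum_boole]
  -- `#A`
  have hAle : (#A : ℝ) ≤ C₀ * (w * ((N : ℝ) / L ^ 2)) := by
    have hA' : A = {p ∈ Nat.primesLE N | (p + h).Prime} := by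
      rw [hA, Nat.primesLE_eq_filter_Icc_one, Finset.filter_filter]
    rw [hA']; exact H N h hN hh
  -- `#B ≤ √N log₂ N`
  have hBle : (#B : ℝ) ≤ Real.sqrt N * (L / Real.log 2) := by
    have hsub : B ⊆ {n ∈ Icc 1 N | ∃ p k : ℕ, 2 ≤ p ∧ 2 ≤ k ∧ p ^ k ≤ N ∧ n + 0 = p ^ k} := by
      intro n hn
      rw [hB, Finset.mem_filter, Finset.mem_Icc] at hn
      obtain ⟨p, k, hp, hk, hnpk⟩ := exists_eq_prime_pow_two_le hn.2.1 hn.2.2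
      rw [Finset.mem_filter, Finset.mem_Icc]
      exact ⟨hn.1, p, k, hp.two_le, hk, by rw [← hnpk]; exact hn.1.2, by rw [add_zero, hnpk]⟩
    have h1 := card_filter_shift_eq_pow_le (Icc 1 N) 0 N 2 (by norm_num)
    have hlog2 : (Nat.log 2 N : ℝ) ≤ L / Real.log 2 := by
      rw [le_div_iff₀ (by linarith), hL, ← Real.log_pow]
      gcongr
      exact_mod_cast Nat.pow_log_le_self 2 (by omega)
    have hsqrt : (N : ℝ) ^ ((1 : ℝ) / (2 : ℕ)) = Real.sqrt N := by
      rw [Real.sqrt_eq_rpow]; norm_num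
    calc (#B : ℝ) ≤ #{n ∈ Icc 1 N | ∃ p k : ℕ, 2 ≤ p ∧ 2 ≤ k ∧ p ^ k ≤ N ∧ n + 0 = p ^ k} := by
          exact_mod_cast Finset.card_le_card hsub
      _ ≤ (N : ℝ) ^ ((1 : ℝ) / (2 : ℕ)) * Nat.log 2 N := h1
      _ ≤ Real.sqrt N * (L / Real.log 2) := by
          rw [hsqrt]; exact mul_le_mul_of_nonneg_left hlog2 (Real.sqrt_nonneg _)
  -- `#Cs ≤ (√N + 1) + (2N²)^{1/3} · 3L/log 2`
  have hCle : (#Cs : ℝ) ≤ (Real.sqrt N + 1) + 2 * (N : ℝ) ^ ((2 : ℝ) / 3) * (3 * L / Real.log 2) := by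
    have hsub : Cs ⊆ {n ∈ Icc 1 N | ∃ p : ℕ, n + h = p ^ 2} ∪
        {n ∈ Icc 1 N | ∃ p k : ℕ, 2 ≤ p ∧ 3 ≤ k ∧ p ^ k ≤ N + h ∧ n + h = p ^ k} := by
      intro n hn
      rw [hCs, Finset.mem_filter, Finset.mem_Icc] at hn
      obtain ⟨p, k, hp, hk, hnpk⟩ := exists_eq_prime_pow_two_le hn.2.1 hn.2.2
      rw [Finset.mem_union, Finset.mem_filter, Finset.mem_filter, Finset.mem_Icc]
      by_cases hk2 : k = 2
      · subst hk2; exact Or.inl ⟨hn.1, p, hnpk⟩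
      · exact Or.inr ⟨hn.1, p, k, hp.two_le, by omega, by rw [← hnpk]; omega, hnpk⟩
    have h1 := card_filter_shift_eq_sq_le N h
    have h2 := card_filter_shift_eq_pow_le (Icc 1 N) h (N + h) 3 (by norm_num)
    have hM : (((N + h : ℕ) : ℝ)) ^ ((1 : ℝ) / (3 : ℕ)) ≤ 2 * (N : ℝ) ^ ((2 : ℝ) / 3) := by
      have hc : ((N + h : ℕ) : ℝ) ≤ 2 * (N : ℝ) ^ 2 := by push_cast; exact hNh
      calc (((N + h : ℕ) : ℝ)) ^ ((1 : ℝ) / (3 : ℕ)) ≤ (2 * (N : ℝ) ^ 2) ^ ((1 : ℝ) / (3 : ℕ)) :=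
            Real.rpow_le_rpow (by positivity) hc (by positivity)
        _ = (2 : ℝ) ^ ((1 : ℝ) / 3) * (N : ℝ) ^ ((2 : ℝ) / 3) := by
            rw [Real.mul_rpow (by norm_num) (by positivity), ← Real.rpow_natCast,
              ← Real.rpow_mul hN0.le]
            norm_num
        _ ≤ 2 * (N : ℝ) ^ ((2 : ℝ) / 3) := by
            gcongr
            calc (2 : ℝ) ^ ((1 : ℝ) / 3) ≤ (2 : ℝ) ^ (1 : ℝ) :=
                  Real.rpow_le_rpow_of_exponent_le (by norm_num) (by norm_num)
              _ = 2 := Real.rpow_one 2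
    have hlog2 : (Nat.log 2 (N + h) : ℝ) ≤ 3 * L / Real.log 2 := by
      rw [le_div_iff₀ (by linarith), ← Real.log_pow]
      calc Real.log (2 ^ Nat.log 2 (N + h)) ≤ Real.log ((N : ℝ) + h) := by
            gcongr
            exact_mod_cast Nat.pow_log_le_self 2 (by omega)
        _ ≤ 3 * L := hlogNh
    calc (#Cs : ℝ) ≤ #({n ∈ Icc 1 N | ∃ p : ℕ, n + h = p ^ 2} ∪
          {n ∈ Icc 1 N | ∃ p k : ℕ, 2 ≤ p ∧ 3 ≤ k ∧ p ^ k ≤ N + h ∧ n + h = p ^ k}) := by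
          exact_mod_cast Finset.card_le_card hsub
      _ ≤ #{n ∈ Icc 1 N | ∃ p : ℕ, n + h = p ^ 2} +
          #{n ∈ Icc 1 N | ∃ p k : ℕ, 2 ≤ p ∧ 3 ≤ k ∧ p ^ k ≤ N + h ∧ n + h = p ^ k} := by
          exact_mod_cast Finset.card_union_le _ _
      _ ≤ (Real.sqrt N + 1) + (((N + h : ℕ) : ℝ)) ^ ((1 : ℝ) / (3 : ℕ)) * Nat.log 2 (N + h) :=
          add_le_add h1 h2
      _ ≤ (Real.sqrt N + 1) + 2 * (N : ℝ) ^ ((2 : ℝ) / 3) * (3 * L / Real.log 2) := by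
          gcongr
  -- numeric absorptions: `s = √N = N^{1/2}`, `L² ≤ 16 s`, `L³ ≤ 729 N^{1/3}`
  set s : ℝ := Real.sqrt N with hs
  have hs_rpow : s = (N : ℝ) ^ ((1 : ℝ) / 2) := by rw [hs, Real.sqrt_eq_rpow]
  have hs0 : 0 ≤ s := Real.sqrt_nonneg _
  have hss : s * s = N := Real.mul_self_sqrt hN0.le
  have hsN : s ≤ N := by rw [hs, Real.sqrt_le_left (by linarith)]; exact hNN2
  have hls : L ^ 2 ≤ 16 * s := log_sq_le_sqrt hN1
  have hL9 : L ≤ 9 * (N : ℝ) ^ ((1 : ℝ) / 9) := log_le_nine_mul_rpow hN0.le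
  have hL3 : L ^ 3 ≤ 729 * (N : ℝ) ^ ((1 : ℝ) / 3) := by
    calc L ^ 3 ≤ (9 * (N : ℝ) ^ ((1 : ℝ) / 9)) ^ 3 := pow_le_pow_left₀ hlogN.le hL9 3
      _ = 729 * (N : ℝ) ^ ((1 : ℝ) / 3) := by
          rw [mul_pow, ← Real.rpow_natCast ((N : ℝ) ^ ((1 : ℝ) / 9)), ← Real.rpow_mul hN0.le]
          norm_num
  have hN13s : (N : ℝ) ^ ((1 : ℝ) / 3) * s ≤ N := by
    rw [hs_rpow, ← Real.rpow_add hN0]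
    calc (N : ℝ) ^ ((1 : ℝ) / 3 + 1 / 2) ≤ (N : ℝ) ^ (1 : ℝ) :=
          Real.rpow_le_rpow_of_exponent_le hN1 (by norm_num)
      _ = N := Real.rpow_one _
  have hN1323 : (N : ℝ) ^ ((1 : ℝ) / 3) * (N : ℝ) ^ ((2 : ℝ) / 3) = N := by
    rw [← Real.rpow_add hN0]; norm_num
  have hN23 : 0 ≤ (N : ℝ) ^ ((2 : ℝ) / 3) := by positivity
  have hjB : L ^ 3 * s ≤ 729 * N := by
    calc L ^ 3 * s ≤ 729 * (N : ℝ) ^ ((1 : ℝ) / 3) * s := mul_le_mul_of_nonneg_right hL3 hs0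
      _ = 729 * ((N : ℝ) ^ ((1 : ℝ) / 3) * s) := by ring
      _ ≤ 729 * N := by linarith
  have hjC1 : L ^ 2 * (s + 1) ≤ 32 * N := by
    calc L ^ 2 * (s + 1) ≤ 16 * s * (s + 1) := mul_le_mul_of_nonneg_right hls (by positivity)
      _ = 16 * (s * s) + 16 * s := by ring
      _ ≤ 16 * N + 16 * N := by rw [hss]; linarith
      _ = 32 * N := by ring
  have hjC2 : L ^ 3 * (N : ℝ) ^ ((2 : ℝ) / 3) ≤ 729 * N := by
    calc L ^ 3 * (N : ℝ) ^ ((2 : ℝ) / 3) ≤ 729 * (N : ℝ) ^ ((1 : ℝ) / 3) * (N : ℝ) ^ ((2 : ℝ) / 3) :=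
          mul_le_mul_of_nonneg_right hL3 hN23
      _ = 729 * N := by rw [mul_assoc, hN1323]
  have hl20 : 0 < Real.log 2 := by linarith
  have h145 : 1 / Real.log 2 ≤ 1.45 := by
    rw [div_le_iff₀ hl20]; linarith only [hl2]
  -- term by term
  have hABC0 : (0 : ℝ) ≤ #A + #B + #Cs := by positivity
  have hT1 : 3 * L ^ 2 * #A ≤ 3 * C₀ * w * N := by
    calc 3 * L ^ 2 * #A ≤ 3 * L ^ 2 * (C₀ * (w * ((N : ℝ) / L ^ 2))) := by gcongr
      _ = 3 * C₀ * w * N * (L ^ 2 / L ^ 2) := by ring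
      _ = 3 * C₀ * w * N := by rw [div_self (pow_ne_zero 2 hlogN.ne'), mul_one]
  have hT2 : 3 * L ^ 2 * #B ≤ 3200 * N := by
    calc 3 * L ^ 2 * #B ≤ 3 * L ^ 2 * (s * (L / Real.log 2)) := by gcongr
      _ = 3 * (1 / Real.log 2) * (L ^ 3 * s) := by ring
      _ ≤ 3 * 1.45 * (729 * N) := by gcongr
      _ ≤ 3200 * N := by linarith
  have hT3 : 3 * L ^ 2 * #Cs ≤ 20000 * N := by
    calc 3 * L ^ 2 * #Cs ≤ 3 * L ^ 2 * ((s + 1) + 2 * (N : ℝ) ^ ((2 : ℝ) / 3) * (3 * L / Real.log 2)) := by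
          gcongr
      _ = 3 * (L ^ 2 * (s + 1)) + 18 * (1 / Real.log 2) * (L ^ 3 * (N : ℝ) ^ ((2 : ℝ) / 3)) := by
          ring
      _ ≤ 3 * (32 * N) + 18 * 1.45 * (729 * N) := by gcongr
      _ ≤ 20000 * N := by linarith
  calc ∑ n ∈ Icc 1 N, Λ n * Λ (n + h) ≤ L * Real.log ((N : ℝ) + h) * (#A + #B + #Cs) := hsum
    _ ≤ L * (3 * L) * (#A + #B + #Cs) := by gcongr
    _ = 3 * L ^ 2 * #A + 3 * L ^ 2 * #B + 3 * L ^ 2 * #Cs := by ring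
    _ ≤ 3 * C₀ * w * N + 3200 * N + 20000 * N := add_le_add (add_le_add hT1 hT2) hT3
    _ ≤ (3 * C₀ + 200000) * w * N := by
        have h1 : (N : ℝ) ≤ w * N := le_mul_of_one_le_left hN0.le hw1
        have h2 : (3 * C₀ + 200000) * w * N = 3 * C₀ * w * N + 200000 * (w * N) := by ring
        rw [h2]; linarith only [h1]

/-! ### Odd shifts -/

/-- For ODD `h`, `Λ(n)Λ(n+h) ≠ 0` forces `n` or `n + h` to be a power of `2`, so
`∑_{n ≤ N} Λ(n)Λ(n+h) ≤ 2 (log₂(N+h) + 1) · log N · log(N+h)`. [folklore] -/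
theorem sum_vonMangoldt_mul_shift_le_of_odd {N h : ℕ} (hh : Odd h) :
    ∑ n ∈ Icc 1 N, Λ n * Λ (n + h) ≤
      2 * ((Nat.log 2 (N + h) : ℝ) + 1) * (Real.log N * Real.log ((N : ℝ) + h)) := by
  classical
  -- support: `n = 2^a` or `n + h = 2^b`
  set S := {n ∈ Icc 1 N | Λ n * Λ (n + h) ≠ 0} with hS
  have hsupp : S ⊆ (Finset.range (Nat.log 2 (N + h) + 1)).image (fun a => 2 ^ a) ∪
      (Finset.range (Nat.log 2 (N + h) + 1)).image (fun b => 2 ^ b - h) := by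
    intro n hn
    rw [hS, Finset.mem_filter, Finset.mem_Icc] at hn
    obtain ⟨⟨hn1, hnN⟩, hΛ⟩ := hn
    have hn' : IsPrimePow n := ArithmeticFunction.vonMangoldt_ne_zero_iff.mp (left_ne_zero_of_mul hΛ)
    have hnh' : IsPrimePow (n + h) :=
      ArithmeticFunction.vonMangoldt_ne_zero_iff.mp (right_ne_zero_of_mul hΛ)
    rw [Finset.mem_union, Finset.mem_image, Finset.mem_image]
    -- one of `n`, `n + h` is even
    rcases Nat.even_or_odd n with hev | hodd
    · -- `n` even prime power ⇒ `n = 2^a`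
      left
      obtain ⟨p, a, hp, ha, rfl⟩ := (isPrimePow_nat_iff n).mp hn'
      have hp2 : p = 2 := by
        have h2 : 2 ∣ p ^ a := hev.two_dvd
        exact ((Nat.prime_dvd_prime_iff_eq Nat.prime_two hp).mp (Nat.prime_two.dvd_of_dvd_pow h2)).symm
      subst hp2
      refine ⟨a, ?_, rfl⟩
      rw [Finset.mem_range, Nat.lt_succ_iff]
      exact Nat.le_log_of_pow_le one_lt_two (hnN.trans (Nat.le_add_right _ _))
    · -- `n` odd ⇒ `n + h` even prime power ⇒ `n + h = 2^b`
      right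
      have hev : Even (n + h) := hodd.add_odd hh
      obtain ⟨p, b, hp, hb, hpb⟩ := (isPrimePow_nat_iff (n + h)).mp hnh'
      have hp2 : p = 2 := by
        have h2 : 2 ∣ p ^ b := hpb ▸ hev.two_dvd
        exact ((Nat.prime_dvd_prime_iff_eq Nat.prime_two hp).mp (Nat.prime_two.dvd_of_dvd_pow h2)).symm
      subst hp2
      refine ⟨b, ?_, by rw [hpb, Nat.add_sub_cancel]⟩
      rw [Finset.mem_range, Nat.lt_succ_iff]
      exact Nat.le_log_of_pow_le one_lt_two (by rw [hpb]; omega)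
  have hcardS : (#S : ℝ) ≤ 2 * ((Nat.log 2 (N + h) : ℝ) + 1) := by
    have h1 : #S ≤ 2 * (Nat.log 2 (N + h) + 1) := by
      calc #S ≤ #((Finset.range (Nat.log 2 (N + h) + 1)).image (fun a => 2 ^ a) ∪
            (Finset.range (Nat.log 2 (N + h) + 1)).image (fun b => 2 ^ b - h)) := Finset.card_le_card hsupp
        _ ≤ #((Finset.range (Nat.log 2 (N + h) + 1)).image (fun a => 2 ^ a)) +
            #((Finset.range (Nat.log 2 (N + h) + 1)).image (fun b => 2 ^ b - h)) := Finset.card_union_le _ _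
        _ ≤ #(Finset.range (Nat.log 2 (N + h) + 1)) + #(Finset.range (Nat.log 2 (N + h) + 1)) :=
            add_le_add Finset.card_image_le Finset.card_image_le
        _ = 2 * (Nat.log 2 (N + h) + 1) := by rw [Finset.card_range]; ring
    exact_mod_cast h1
  -- each term is `≤ log N · log (N + h)`
  have hlogN : 0 ≤ Real.log N := Real.log_natCast_nonneg N
  have hlogNh : 0 ≤ Real.log ((N : ℝ) + h) := by
    have : Real.log ((N : ℝ) + h) = Real.log ((N + h : ℕ) : ℝ) := by push_cast; ring_nf
    rw [this]; exact Real.log_natCast_nonneg _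
  have hterm : ∀ n ∈ Icc 1 N, Λ n * Λ (n + h) ≤ Real.log N * Real.log ((N : ℝ) + h) := by
    intro n hn
    rw [Finset.mem_Icc] at hn
    have hΛn : Λ n ≤ Real.log N :=
      ArithmeticFunction.vonMangoldt_le_log.trans
        (Real.log_le_log (by exact_mod_cast hn.1) (by exact_mod_cast hn.2))
    have hΛnh : Λ (n + h) ≤ Real.log ((N : ℝ) + h) := by
      refine ArithmeticFunction.vonMangoldt_le_log.trans
        (Real.log_le_log (by exact_mod_cast (show 0 < n + h by omega)) ?_)
      push_cast; exact_mod_cast (show n + h ≤ N + h by omega)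
    exact mul_le_mul hΛn hΛnh ArithmeticFunction.vonMangoldt_nonneg hlogN
  calc ∑ n ∈ Icc 1 N, Λ n * Λ (n + h) = ∑ n ∈ S, Λ n * Λ (n + h) := by
        rw [hS, Finset.sum_filter_ne_zero]
    _ ≤ ∑ n ∈ S, Real.log N * Real.log ((N : ℝ) + h) :=
        Finset.sum_le_sum fun n hn => hterm n (Finset.mem_of_mem_filter n hn)
    _ = #S * (Real.log N * Real.log ((N : ℝ) + h)) := by rw [Finset.sum_const, nsmul_eq_mul]
    _ ≤ 2 * ((Nat.log 2 (N + h) : ℝ) + 1) * (Real.log N * Real.log ((N : ℝ) + h)) :=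
        mul_le_mul_of_nonneg_right hcardS (mul_nonneg hlogN hlogNh)

end PrimePairsVonMangoldt

end Literature.NumberTheory.Sieve
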